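import Summits.ValiantsHypothesis.ValiantsHypothesis.Theorems.SymPencilSingSixClassificationTheoremA
import Summits.ValiantsHypothesis.ValiantsHypothesis.Theorems.SymPencilSingSixClassificationZeroLine

/-!
# Route `SymPencil` — row `r = 10` of the size-`28` table: the threshold-shifted declarations of
# `SymPencilSingSixClassificationTheoremA` (`--supports` stmt-ValiantsHypothesis-5674 `SdcSuperquadratic`; rung currency only)

The declarations below (suffix `_m28`) are those of the landed `…Theorems.SymPencilSingSixClassificationTheoremA` whose meaning
changes when its numerical thresholds move by one unit — `Fin 6 → Fin 7` square families /
`|ι'| ≤ 26 → ≤ 27` / `m ≤ 27 → m ≤ 28`, as applicable — with proofs VERBATIM; unchanged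
declarations are used from the original module by name (same namespace).  Why it elaborates
(m = 28 table audit, val-lit-p6 g17, 2026-08-29; reader of record val-idea-crit-5 g4, probe P31):
the leaves of the `(10, 6)` chain are stated for `card ι < 8` / `< 9`, and every size lever reads
`4·rk bL ≤ 2·dim K + |ι'|` through integer division — one unit of slack throughout.  The `_m28`
statements imply the landed ones.

Honest framing: part of ONE row (cell `(10, 6, 7)`) of the size-`28` table; nothing about
`sdc(per_4)` follows here; `28 ≤ sdc(per_4) ≤ 29` of record, the crux `SdcSuperquadratic` and
`VP ≠ VNP` untouched.  Credit: mathematics and proof text of `SymPencilSingSixClassificationTheoremA` (its authors); this file only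
moves the bound.  No definitions, no named facts. [folklore]
-/

noncomputable section
set_option linter.dupNamespace false
set_option linter.unusedVariables false
set_option linter.unusedSectionVars false

namespace Summit.ValiantsHypothesis.ValiantsHypothesis.Theorems.SymPencilSingSixClassification

open MvPolynomial Module Literature.Computability.AlgebraicComplexity
open Literature.Barriers.CriticalPhenomena.Haruspicy (fin4_cases)
variable {K : Type*} [Field K]

/-- **LIST — the V-side list of cell `(10,6,6)`** from the five leaves: a `6`-dimensional singular `W`
with a per-direction family of `≤ 6` squares is of `V×`-, `W_col`- or `W₂`-type (or transposed). -/
theorem sixDim_perDir_list_of_m28 [CharZero K]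
    (h1 : ∀ W : Submodule K (Fin 4 × Fin 4 → K), Sing3 W → 5 ≤ finrank K W →
      InCross W ∨ (∃ i : Fin 4, ∀ x ∈ W, ∀ j : Fin 4, x (i, j) = 0) ∨
        (∃ j : Fin 4, ∀ x ∈ W, ∀ i : Fin 4, x (i, j) = 0))
    (h2 : ∀ W : Submodule K (Fin 4 × Fin 4 → K), Sing3 W → finrank K W = 6 →
      ((∃ i : Fin 4, ∀ x ∈ W, ∀ j : Fin 4, x (i, j) = 0) ∨
        (∃ j : Fin 4, ∀ x ∈ W, ∀ i : Fin 4, x (i, j) = 0)) →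
      InCross W ∨ TwoZeroRows W ∨ TwoZeroCols W ∨
        VLambdaRows W ∨ VGraphRows W ∨ VLambdaCols W ∨ VGraphCols W)
    (h3 : ∀ W : Submodule K (Fin 4 × Fin 4 → K),
      (VLambdaRows W ∨ VGraphRows W ∨ VLambdaCols W ∨ VGraphCols W) → ¬ (∀ y ∈ W, ∃ (c : Fin 7 → K) (Λ : Fin 7 → ((Fin 4 × Fin 4 → K) →ₗ[K] K)),
        ∀ u : Fin 4 × Fin 4 → K, ∃ e₀ e₁ : K, ∀ s : K,
          eval (u + s • y) (perPoly (Fin 4) K) = e₀ + s * e₁ + s ^ 2 * ∑ k, c k * (Λ k u) ^ 2))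
    (h4 : ∀ W : Submodule K (Fin 4 × Fin 4 → K), finrank K W = 6 → InCross W → (∀ y ∈ W, ∃ (c : Fin 7 → K) (Λ : Fin 7 → ((Fin 4 × Fin 4 → K) →ₗ[K] K)),
        ∀ u : Fin 4 × Fin 4 → K, ∃ e₀ e₁ : K, ∀ s : K,
          eval (u + s • y) (perPoly (Fin 4) K) = e₀ + s * e₁ + s ^ 2 * ∑ k, c k * (Λ k u) ^ 2) →
      VCrossType W)
    (h5 : ∀ W : Submodule K (Fin 4 × Fin 4 → K), finrank K W = 6 → (TwoZeroRows W ∨ TwoZeroCols W) →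
      (∀ y ∈ W, ∃ (c : Fin 7 → K) (Λ : Fin 7 → ((Fin 4 × Fin 4 → K) →ₗ[K] K)),
        ∀ u : Fin 4 × Fin 4 → K, ∃ e₀ e₁ : K, ∀ s : K,
          eval (u + s • y) (perPoly (Fin 4) K) = e₀ + s * e₁ + s ^ 2 * ∑ k, c k * (Λ k u) ^ 2) → WColType W ∨ W2Type W ∨ WColTypeT W ∨ W2TypeT W) :
    ∀ W : Submodule K (Fin 4 × Fin 4 → K), Sing3 W → finrank K W = 6 → (∀ y ∈ W, ∃ (c : Fin 7 → K) (Λ : Fin 7 → ((Fin 4 × Fin 4 → K) →ₗ[K] K)),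
        ∀ u : Fin 4 × Fin 4 → K, ∃ e₀ e₁ : K, ∀ s : K,
          eval (u + s • y) (perPoly (Fin 4) K) = e₀ + s * e₁ + s ^ 2 * ∑ k, c k * (Λ k u) ^ 2) →
      VCrossType W ∨ WColType W ∨ W2Type W ∨ WColTypeT W ∨ W2TypeT W := by
  intro W hS h6 hP
  rcases sixDim_classification_of h1 h2 W hS h6 with hX | hR | hC | hE | hE | hE | hE
  · exact Or.inl (h4 W h6 hX hP)
  · exact Or.inr (h5 W h6 (Or.inl hR) hP)
  · exact Or.inr (h5 W h6 (Or.inr hC) hP)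
  · exact absurd hP (h3 W (Or.inl hE))
  · exact absurd hP (h3 W (Or.inr (Or.inl hE)))
  · exact absurd hP (h3 W (Or.inr (Or.inr (Or.inl hE))))
  · exact absurd hP (h3 W (Or.inr (Or.inr (Or.inr hE))))
end Summit.ValiantsHypothesis.ValiantsHypothesis.Theorems.SymPencilSingSixClassification

end
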